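import Literature.MathematicalPhysics.QuantumFieldTheory.BalabanImbrieJaffe1984to88.BIJ88RemovedFieldBounds286
import Literature.MathematicalPhysics.QuantumFieldTheory.BalabanImbrieJaffe1984to88.BIJ88Sect3Translations

/-!
# `BalabanImbrieJaffe1984to88.BIJ88FieldStrength562` — T. Bałaban, J. Imbrie, A. Jaffe, *Effective action and cluster properties of the
abelian Higgs model*, Commun. Math. Phys. **114** (1988) 257–315 [BalabanImbrieJaffe1988], (5.6.2) p. 286 [PDF 30], verbatim: *"The
corresponding background field strength is given by f̃^η_{k+1}(p) = (ie_kη²)⁻¹ log ũ_{k+1}(p). (5.6.2)"*, and the display of p. 288 [PDF 32],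
verbatim: *"We also have the field strength expanded as f′_k = f̃^η_{k+1} + ∂w₁A′ + ∂(θ_kH_{k,loc}A^{(k)})."* — PROVED as identities of the principal-
branch field strength (r18's (4.13) `BIJ88Sect4Statements.fK e_k η = (ie_kη²)⁻¹ log`) of r18's plaquette variable `BIJ88Sect3Statements.plaqVar`
for the (5.5.14) field `u′_k` and the (5.6.1) field `ũ_{k+1}` (r16's `uTilde561`), under the displayed principal-branch (small-field) conditions;
with the form of (5.6.2) on `Λ̄₆^{(k)**}` — *"except for scaling, this reduces to the form in the induction hypothesis"* — for the concrete
`(k+1)`-fold pull-back on the torus: `f̃^η_{k+1} = L⁻²[Q^{e*}_{k+1}f − ∂^η(𝒟^η_{k+1,loc}∂^{η*}Q^{e*}_{k+1}f)]`, the (4.13) shape with the factor `L⁻²`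
that the scaling (5.15.3) removes.

statement-level skeleton of published theorems with citation tags; proofs where landed; nothing here is a claim about the Yang–Mills mass gap

PDF held: `paper:balaban1988-cmp114-bij-abelian-higgs-effective-action` (journal page = PDF page + 256); pp. 286, 288 [PDF 30, 32] read as images
this session (seat folder `pages/original-p030-x2.png`, the cell's render `lit-balaban-r16/renders/cmp114/original-p032-x2.png`).

CITATION HEADER (lean-in-tree rule).  Part of the lit-balaban TYPED SKELETON (HOME `run/shared/lean/pub/lit-balaban/`), PHASE-2 proof seat p31
gen 9 (unit `lit-balaban-p31-g9`; second file of the gen; TAKING line HOME/STATUS.md).  WHAT IS REPRODUCED: rows `C2.Eq5.6.1-5.6.2` ((5.6.2);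
owner r16, `HOME/lit-balaban-r16/ROWS-C2-part2.md`: *"(5.6.2) = BIJ88Sect4Statements.fK"*) and `C2.Eq5.6.6-5.6.12` (the p. 288 display after
(5.6.12), not separately numbered), continuing this seat's gen-8 `BIJ88Eq5514Torus` (`eq566_torus`, `uTilde561_eq_backgroundU_of_mem`) and
`BIJ88Regularity561` (`bgExp_bracket5514` = (5.6.6) as an identity of fields) and gen-3 `BIJ88SurfacePhase325.fK_background_torus` ((4.13) at `k`).

THE MECHANISM.  (5.6.6): `u′_k = ũ_{k+1}·ũ`, `ũ = exp ie_kη[θ_kH_{k,loc}A^{(k)} + w₁A′] = e^{ie_kηg}` (r16's `eq566`/`uSmall566`).  The plaquette variable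
is multiplicative (r18's `plaqVar_mul`) and that of a pure phase is the phase of the curl (`plaqVar_phase`): `ũ(∂p) = exp(ie_kη·(∂¹g)(p)) =
exp(ie_kη²(∂^ηg)(p))` (`∂^η = curl η⁻¹`, `∂¹ = η∂^η`).  On the principal branch, `log(z·e^{iα}) = log z + iα` exactly when `α ∈ (−π, π]` and
`arg z + α ∈ (−π, π]` (Mathlib `Complex.log_mul`, `Complex.log_exp`) — the small-field regime of Sect. 5 (`|arg u(p)| ≦ e_kp(e_k)`, removed fields
`O(p(e_k))`, `e_k` small); hence `f′_k(p) = (ie_kη²)⁻¹ log u′_k(p) = (ie_kη²)⁻¹ log ũ_{k+1}(p) + (∂^ηg)(p) = f̃^η_{k+1}(p) + ∂(θ_kH_{k,loc}A^{(k)})(p) +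
∂(w₁A′)(p)`.  In `Λ̄₆^{(k)*}` `θ_k = 1` and `ũ_{k+1} = (Q^{s*}_{k+1}v)·exp(−ie_kηL⁻²𝒟^η_{k+1,loc}X_f)` (r16's `uTilde561_of_theta_eq_one`), so on a plaquette
of `Λ̄₆^{(k)**}`: `f̃^η_{k+1}(p) = (ie_kη²)⁻¹ log (Q^{s*}_{k+1}v)(∂p) − L⁻²(∂^η𝒟^η_{k+1,loc}X_f)(p)`; for the concrete pull-back `(Q^{s*}_{k+1}v)(∂p) = v(∂p′)`
on the `(k+1)`-fold edge plaquettes `p ∈ B^e_{k+1}(p′)` and `= 1` elsewhere (this seat's gen-3 `BIJ85Eq453GaugeField.plaqHol_qsstarGIter_of_mem/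
_of_not_mem`), and `(ie_kη²)⁻¹ log v(p′) = η⁻²f(p′)` with `f(p′) = (ie_k)⁻¹ log v(p′)` of p. 280 (r18's `fieldStrength e_k`); with `ηLᵏ = 1`,
`η⁻²f(p′)·[p ∈ B^e_{k+1}(p′)] = L⁻²(Q^{e*}_{k+1}f)(p)` for the `(k+1)`-fold edge geometry's `Cells.Qstar` (factor `L^{2(k+1)}`, gen-2
`BIJ85Eq224ProofPart2.torusEdgeCellsIter`).

WHAT IS PROVED (0 `sorry`, standard axioms; theorems only).
* §1 `curl_one_eq_mul` (`∂¹ = η∂^η`), `curl_const_mul`, `plaqVar_congr_starP`, `plaqVar_bgExp` (`(Q e^{ie ηX})(∂p) = Q(∂p)·e^{ieη²∂^ηX(p)}`),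
  `backgroundU_eq_bgExp_neg`, `plaqVar_backgroundU`, `plaqVar_uSmall566`.
* §2 `fK_mul_exp` (principal branch: `f_K(z·e^{ieη²t}) = f_K(z) + t`), `fK_one`, `fK_eq_fieldStrength` (`(ie η²)⁻¹log = η⁻²·(ie)⁻¹log`).
* §3 **`fK_eq5514`** — the p. 288 display `f′_k = f̃^η_{k+1} + ∂^η(θ_kH_{k,loc}A^{(k)} + w₁A′)` (abstract prefactor `Q`, any `θ_k`, `L`), and
  `fK_eq5514_add` (the printed three-term form `f̃^η_{k+1} + ∂w₁A′ + ∂(θ_kH_{k,loc}A^{(k)})`).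
* §4 **`fK_uTilde561_of_mem_starP`** — (5.6.2) on `Λ̄₆^{(k)**}`: `f̃^η_{k+1}(p) = f_K((Q^{s*}_{k+1}v)(∂p)) − L⁻²∂^η(𝒟^η_{k+1,loc}X_f)(p)` (abstract `Q`).
* §5 the torus: `plaqVar_qsstarGIter_of_mem/_of_not_mem`, **`fK_uTilde561_torus_of_mem`** (`f̃^η_{k+1}(p) = η⁻²f(p′) − L⁻²(∂^η DXf)(p)` on
  `p ∈ B^e_{k+1}(p′)`), `fK_uTilde561_torus_of_not_mem` (`= −L⁻²(∂^η DXf)(p)` off the edge plaquettes), and the (4.13)-shape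
  **`fK_uTilde561_torus_eq_Qstar`**: `f̃^η_{k+1}(p) = L⁻²[(Q^{e*}_{k+1}f)(p) − (∂^η DXf)(p)]` under `ηLᵏ = 1`.
HONEST SCOPE.  Exact identities under DISPLAYED principal-branch hypotheses (membership of the relevant phases in `(−π, π]`), which the
small-field restrictions of Sect. 5 supply but which are not derived here; `DXf = 𝒟^η_{k+1,loc}∂^{η*}Q^{e*}_{k+1}f` enters as a bond function (no
kernel analysis); the scaling (5.15.3) itself is not performed (the factor `L⁻²` is displayed).  Imports: this seat's `BIJ88RemovedFieldBounds286`
(p303966; → `BIJ88Regularity561`, `BIJ88Eq5514Torus`) and r18's `BIJ88Sect3Translations` (`plaqVar_mul`, `plaqVar_phase`).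
Unit `lit-balaban-p31` (literature-prover-lit-balaban-p31-g9-0), 2026-08-21.  NOT summit progress.
-/

namespace Literature.MathematicalPhysics.QuantumFieldTheory.BalabanImbrieJaffe1984to88.BIJ88FieldStrength562

open Literature.MathematicalPhysics.QuantumFieldTheory.Balaban1983to89
open BIJ88Sect3Statements (U1 toC cfg plaqVar plaqVar_cfg fieldStrength starB starP toC_one norm_toC)
open BIJ88Sect3Translations (phase plaqVar_mul plaqVar_phase)
open BIJ88Sect4Statements (fK backgroundU)
open BIJ88Sect5StatementsPart3 (bgExp uTilde561 uSmall566 IsTheta561 uTilde561_of_theta_eq_one)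
open BIJ88Regularity561 (bgExp_bracket5514)
open BIJ88Eq542Torus (bonds_mem_starB_of_mem_starP)
open BIJ85Eq453GaugeField (qsstarGIter plaqHol_qsstarGIter_of_mem plaqHol_qsstarGIter_of_not_mem)
open BIJ85Eq224ProofPart2 (torusEdgeCellsIter iterE_L)
open BIJ85CellAverages (Cells)
open LatticeFieldCalculus (curl curl_add)
open scoped BigOperators
open Complex

noncomputable section

variable {P : Params} {n : ℕ}

/-! ## §1  Plaquette variables of translated fields -/

/-- kernel: `∂¹ = η∂^η` — the unit-normalized curl is `η` times the η-lattice curl `curl η⁻¹` (`η ≠ 0`).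
[cite: BalabanImbrieJaffe1988, (5.6.2) p.286] -/
theorem curl_one_eq_mul {η : ℝ} (hη : η ≠ 0) (X : PBond P n → ℝ) (p : Balaban1983to89.Plaq P n) :
    curl 1 X p = η * curl η⁻¹ X p := by
  simp only [curl, smul_eq_mul, one_mul]
  rw [← mul_assoc, mul_inv_cancel₀ hη, one_mul]

/-- kernel: the curl is linear — a constant factor comes out. [cite: BalabanImbrieJaffe1988, (5.6.2) p.286] -/
theorem curl_const_mul (c a : ℝ) (X : PBond P n → ℝ) (p : Balaban1983to89.Plaq P n) :
    curl c (fun b => a * X b) p = a * curl c X p := by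
  simp only [curl, smul_eq_mul]
  ring

/-- kernel: the plaquette variable of `p ∈ X**` only reads the field on the bonds of `X*` (the four bonds of `p` lie in `X*`, this seat's
gen-7 `bonds_mem_starB_of_mem_starP`). [cite: BalabanImbrieJaffe1988, (5.6.2) p.286] -/
theorem plaqVar_congr_starP {u v : PBond P n → ℂ} (X : Finset (Balaban1983to89.Site P n)) {p : Balaban1983to89.Plaq P n}
    (hp : p ∈ starP X) (h : ∀ b ∈ starB X, u b = v b) : plaqVar u p = plaqVar v p := by
  obtain ⟨h0, h1, h2, h3⟩ := bonds_mem_starB_of_mem_starP X hp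
  simp only [plaqVar, h _ h0, h _ h1, h _ h2, h _ h3]

/-- kernel: **the plaquette variable of a translated field** `Q·e^{ieηX}` (r16's `bgExp`) is that of `Q` times the phase of the η-curl:
`(Q e^{ieηX})(∂p) = Q(∂p)·exp(ieη²(∂^ηX)(p))`. [cite: BalabanImbrieJaffe1988, (5.6.2) p.286] -/
theorem plaqVar_bgExp {e η : ℝ} (hη : η ≠ 0) (Q : PBond P n → ℂ) (X : PBond P n → ℝ) (p : Balaban1983to89.Plaq P n) :
    plaqVar (bgExp e η Q X) p = plaqVar Q p * exp (I * ((e * η ^ 2 * curl η⁻¹ X p : ℝ) : ℂ)) := by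
  have hfun : bgExp e η Q X = fun b => Q b * phase (e * η) X b := by
    funext b; simp only [bgExp, phase]
  rw [hfun, plaqVar_mul, plaqVar_phase, curl_one_eq_mul hη X p]
  congr 3
  push_cast
  ring

/-- kernel: r18's (4.2) form is r16's translation form with the opposite sign, `Q·e^{−ieηg} = bgExp e η Q (−g)`.
[cite: BalabanImbrieJaffe1988, (4.2) p.274] -/
theorem backgroundU_eq_bgExp_neg (e η : ℝ) (Q : PBond P n → ℂ) (g : PBond P n → ℝ) :
    backgroundU e η Q g = bgExp e η Q (fun b => -g b) := by
  funext b
  simp only [backgroundU, bgExp]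
  congr 1
  push_cast
  ring

/-- kernel: `(Q e^{−ieηg})(∂p) = Q(∂p)·exp(−ieη²(∂^ηg)(p))` (written with `t = −(∂^ηg)(p)`). [cite: BalabanImbrieJaffe1988, (4.13) p.275] -/
theorem plaqVar_backgroundU {e η : ℝ} (hη : η ≠ 0) (Q : PBond P n → ℂ) (g : PBond P n → ℝ) (p : Balaban1983to89.Plaq P n) :
    plaqVar (backgroundU e η Q g) p = plaqVar Q p * exp (I * ((e * η ^ 2 * (-curl η⁻¹ g p) : ℝ) : ℂ)) := by
  rw [backgroundU_eq_bgExp_neg, plaqVar_bgExp hη]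
  have h := curl_const_mul η⁻¹ (-1) g p
  simp only [neg_mul, one_mul] at h
  rw [h]

/-- kernel: **`ũ(∂p) = exp(ie_kη²∂^η[θ_kH_{k,loc}A^{(k)} + w₁A′](p))`** — the plaquette variable of the small multiplicative field of (5.6.6)
(r16's `uSmall566`). [cite: BalabanImbrieJaffe1988, (5.6.6) p.287] -/
theorem plaqVar_uSmall566 {e η : ℝ} (hη : η ≠ 0) (θ HA wA : PBond P n → ℝ) (p : Balaban1983to89.Plaq P n) :
    plaqVar (uSmall566 e η θ HA wA) p = exp (I * ((e * η ^ 2 * curl η⁻¹ (fun b => θ b * HA b + wA b) p : ℝ) : ℂ)) := by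
  have hfun : uSmall566 e η θ HA wA = phase (e * η) (fun b => θ b * HA b + wA b) := by
    funext b; simp only [uSmall566, phase]
  rw [hfun, plaqVar_phase, curl_one_eq_mul hη _ p]
  congr 2
  push_cast
  ring

/-! ## §2  The principal-branch field strength `f_K = (ie_kη²)⁻¹ log` of a product -/

/-- kernel: **`f_K(z·e^{ie_kη²t}) = f_K(z) + t` on the principal branch** — exactly when `e_kη²t ∈ (−π, π]` and `arg z + e_kη²t ∈ (−π, π]`
(`z ≠ 0`; Mathlib's `Complex.log_mul`/`log_exp`).  This is the step *"f′_k = f̃^η_{k+1} + …"* of p. 288 and *"(ie_kη²)⁻¹ log ũ_{k+1}(p)"* of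
(5.6.2) evaluated on a product. [cite: BalabanImbrieJaffe1988, (5.6.2) p.286] -/
theorem fK_mul_exp {e η t : ℝ} {z : ℂ} (he : e ≠ 0) (hη : η ≠ 0) (hz : z ≠ 0) (ht : e * η ^ 2 * t ∈ Set.Ioc (-Real.pi) Real.pi)
    (hsum : arg z + e * η ^ 2 * t ∈ Set.Ioc (-Real.pi) Real.pi) :
    fK e η (z * exp (I * ((e * η ^ 2 * t : ℝ) : ℂ))) = fK e η z + t := by
  have him : (I * ((e * η ^ 2 * t : ℝ) : ℂ)).im = e * η ^ 2 * t := by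
    simp only [mul_im, I_re, I_im, ofReal_re, ofReal_im, zero_mul, one_mul, zero_add]
  have hlog : log (exp (I * ((e * η ^ 2 * t : ℝ) : ℂ))) = I * ((e * η ^ 2 * t : ℝ) : ℂ) :=
    log_exp (by rw [him]; exact ht.1) (by rw [him]; exact ht.2)
  have harg : arg (exp (I * ((e * η ^ 2 * t : ℝ) : ℂ))) = e * η ^ 2 * t := by
    rw [← log_im, hlog, him]
  have hmul : log (z * exp (I * ((e * η ^ 2 * t : ℝ) : ℂ))) = log z + I * ((e * η ^ 2 * t : ℝ) : ℂ) := by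
    rw [Complex.log_mul hz (exp_ne_zero _) (by rw [harg]; exact hsum), hlog]
  have he' : (e : ℂ) ≠ 0 := ofReal_ne_zero.2 he
  have hη' : (η : ℂ) ≠ 0 := ofReal_ne_zero.2 hη
  have hI : I * (e : ℂ) * (η : ℂ) ^ 2 ≠ 0 := mul_ne_zero (mul_ne_zero I_ne_zero he') (pow_ne_zero 2 hη')
  simp only [fK, hmul, mul_add]
  congr 1
  push_cast
  rw [show I * ((e : ℂ) * (η : ℂ) ^ 2 * (t : ℂ)) = (I * (e : ℂ) * (η : ℂ) ^ 2) * (t : ℂ) by ring, ← mul_assoc,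
    inv_mul_cancel₀ hI, one_mul]

/-- kernel: `f_K(1) = 0`. [cite: BalabanImbrieJaffe1988, (5.6.2) p.286] -/
theorem fK_one (e η : ℝ) : fK e η 1 = 0 := by
  simp [fK]

/-- kernel: `(ie_kη²)⁻¹ log z = η⁻²·(ie_k)⁻¹ log z` — r18's (4.13)/(5.6.2) field strength is `η⁻²` times the p. 280 field strength
`f = (ie_k)⁻¹ log` (`BIJ88Sect3Statements.fieldStrength e_k`). [cite: BalabanImbrieJaffe1988, (5.6.2) p.286] -/
theorem fK_eq_fieldStrength (e η : ℝ) (z : ℂ) : fK e η z = ((η : ℂ) ^ 2)⁻¹ * fieldStrength e z := by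
  simp only [fK, fieldStrength, mul_inv_rev]
  ring

/-! ## §3  p. 288: «f′_k = f̃^η_{k+1} + ∂w₁A′ + ∂(θ_kH_{k,loc}A^{(k)})» -/

/-- **The p. 288 display** [PDF 32], verbatim: *"We also have the field strength expanded as f′_k = f̃^η_{k+1} + ∂w₁A′ + ∂(θ_kH_{k,loc}A^{(k)})."* —
for the (5.5.14) field `u′_k = (Q^{s*}_{k+1}v) exp ie_kη[H_{k,loc}A^{(k)} − L⁻²DXf + w₁A′]` (r16's `bgExp`, abstract prefactor `Q`) and the (5.6.1)
field `ũ_{k+1}` (r16's `uTilde561`, any `θ_k`, `L`): `(ie_kη²)⁻¹ log u′_k(p) = (ie_kη²)⁻¹ log ũ_{k+1}(p) + ∂^η[θ_kH_{k,loc}A^{(k)} + w₁A′](p)` on the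
principal branch, i.e. when `ũ_{k+1}(p) ≠ 0`, `e_kη²∂^ηg(p) ∈ (−π, π]` and `arg ũ_{k+1}(p) + e_kη²∂^ηg(p) ∈ (−π, π]` (`g` the removed field).
Mechanism: (5.6.6) `u′_k = ũ_{k+1}·ũ` (gen-8 `bgExp_bracket5514`), `plaqVar_bgExp`, `fK_mul_exp`. [cite: BalabanImbrieJaffe1988, (5.6.6) p.288] -/
theorem fK_eq5514 {e η : ℝ} (he : e ≠ 0) (hη : η ≠ 0) (L : ℝ) (Q : PBond P n → ℂ) (θ HA DXf wA : PBond P n → ℝ)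
    (p : Balaban1983to89.Plaq P n) (hz : plaqVar (uTilde561 e η L Q θ HA DXf) p ≠ 0)
    (ht : e * η ^ 2 * curl η⁻¹ (fun b => θ b * HA b + wA b) p ∈ Set.Ioc (-Real.pi) Real.pi)
    (hsum : arg (plaqVar (uTilde561 e η L Q θ HA DXf) p) + e * η ^ 2 * curl η⁻¹ (fun b => θ b * HA b + wA b) p ∈
      Set.Ioc (-Real.pi) Real.pi) :
    fK e η (plaqVar (bgExp e η Q (fun b => HA b - L⁻¹ ^ 2 * DXf b + wA b)) p) =
      fK e η (plaqVar (uTilde561 e η L Q θ HA DXf) p) + curl η⁻¹ (fun b => θ b * HA b + wA b) p := by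
  rw [bgExp_bracket5514 e η L Q θ HA DXf wA, plaqVar_bgExp hη]
  exact_mod_cast fK_mul_exp he hη hz ht hsum

/-- **The p. 288 display in its printed three-term form** `f′_k = f̃^η_{k+1} + ∂w₁A′ + ∂(θ_kH_{k,loc}A^{(k)})` (`∂ = ∂^η`, the curl being additive).
[cite: BalabanImbrieJaffe1988, (5.6.6) p.288] -/
theorem fK_eq5514_add {e η : ℝ} (he : e ≠ 0) (hη : η ≠ 0) (L : ℝ) (Q : PBond P n → ℂ) (θ HA DXf wA : PBond P n → ℝ)
    (p : Balaban1983to89.Plaq P n) (hz : plaqVar (uTilde561 e η L Q θ HA DXf) p ≠ 0)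
    (ht : e * η ^ 2 * curl η⁻¹ (fun b => θ b * HA b + wA b) p ∈ Set.Ioc (-Real.pi) Real.pi)
    (hsum : arg (plaqVar (uTilde561 e η L Q θ HA DXf) p) + e * η ^ 2 * curl η⁻¹ (fun b => θ b * HA b + wA b) p ∈
      Set.Ioc (-Real.pi) Real.pi) :
    fK e η (plaqVar (bgExp e η Q (fun b => HA b - L⁻¹ ^ 2 * DXf b + wA b)) p) =
      fK e η (plaqVar (uTilde561 e η L Q θ HA DXf) p) + curl η⁻¹ wA p + curl η⁻¹ (fun b => θ b * HA b) p := by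
  rw [fK_eq5514 he hη L Q θ HA DXf wA p hz ht hsum, curl_add η⁻¹ (fun b => θ b * HA b) wA p]
  push_cast
  ring

/-! ## §4  (5.6.2) on `Λ̄₆^{(k)**}`: «except for scaling, this reduces to the form in the induction hypothesis» -/

/-- **(5.6.2) on `Λ̄₆^{(k)**}`**: for `θ_k` with the printed support clauses (r16's `IsTheta561 Λ̄₆* Λ̄₅* θ_k`, `Λ̄₆* = starB Λ6`) and a plaquette
`p ∈ Λ̄₆**` (`starP Λ6`), the new field strength is `f̃^η_{k+1}(p) = (ie_kη²)⁻¹ log (Q^{s*}_{k+1}v)(∂p) − L⁻²(∂^η DXf)(p)` — r18's (4.13) shape for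
the (4.2) form `ũ_{k+1} = (Q^{s*}_{k+1}v)e^{−ie_kηL⁻²DXf}` (r16's `uTilde561_of_theta_eq_one`), abstract prefactor `Q`, on the principal branch
(`Q(∂p) ≠ 0`, `−e_kη²L⁻²(∂^η DXf)(p) ∈ (−π, π]`, `arg Q(∂p) − e_kη²L⁻²(∂^η DXf)(p) ∈ (−π, π]`). [cite: BalabanImbrieJaffe1988, (5.6.2) p.286] -/
theorem fK_uTilde561_of_mem_starP {e η : ℝ} (he : e ≠ 0) (hη : η ≠ 0) (L : ℝ) (Q : PBond P n → ℂ)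
    {Λ6 : Finset (Balaban1983to89.Site P n)} {Λ5s : Set (PBond P n)} {θ : PBond P n → ℝ}
    (hθ : IsTheta561 (↑(starB Λ6) : Set (PBond P n)) Λ5s θ) (HA DXf : PBond P n → ℝ) {p : Balaban1983to89.Plaq P n}
    (hp : p ∈ starP Λ6) (hz : plaqVar Q p ≠ 0)
    (ht : e * η ^ 2 * (-(L⁻¹ ^ 2 * curl η⁻¹ DXf p)) ∈ Set.Ioc (-Real.pi) Real.pi)
    (hsum : arg (plaqVar Q p) + e * η ^ 2 * (-(L⁻¹ ^ 2 * curl η⁻¹ DXf p)) ∈ Set.Ioc (-Real.pi) Real.pi) :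
    fK e η (plaqVar (uTilde561 e η L Q θ HA DXf) p) = fK e η (plaqVar Q p) - L⁻¹ ^ 2 * curl η⁻¹ DXf p := by
  have hcongr : plaqVar (uTilde561 e η L Q θ HA DXf) p = plaqVar (backgroundU e η Q fun b => L⁻¹ ^ 2 * DXf b) p :=
    plaqVar_congr_starP Λ6 hp fun b hb => uTilde561_of_theta_eq_one e η L Q HA DXf (hθ.1 b (Finset.mem_coe.2 hb))
  rw [hcongr, plaqVar_backgroundU hη, curl_const_mul]
  have h := fK_mul_exp he hη hz ht hsum
  push_cast at h ⊢
  rw [h]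
  ring

/-! ## §5  The torus: the concrete `(k+1)`-fold pull-back `Q^{s*}_{k+1}v` -/

variable {i : ℕ}

/-- kernel: on a `(k+1)`-fold edge plaquette `p ∈ B^e_{k+1}(p′)` the plaquette variable of the pull-back is that of the coarse field,
`(Q^{s*}_{k+1}v)(∂p) = v(∂p′)` (this seat's gen-3 `plaqHol_qsstarGIter_of_mem`, read in `ℂ` through r18's `plaqVar_cfg`).
[cite: BalabanImbrieJaffe1988, (5.6.2) p.286] -/
theorem plaqVar_qsstarGIter_of_mem (hd : 2 ≤ P.d) {k : ℕ} (hk : i + k ≤ P.m + P.K) (v : GaugeField P (i + k) U1)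
    {p : Balaban1983to89.Plaq P i} {p' : Balaban1983to89.Plaq P (i + k)} (hp : p ∈ (torusEdgeCellsIter P i k hd).B p') :
    plaqVar (fun b => toC (qsstarGIter k v b)) p = toC (GaugeField.plaqHol v p') := by
  have h : plaqVar (fun b => toC (qsstarGIter k v b)) p = toC (GaugeField.plaqHol (qsstarGIter k v) p) :=
    plaqVar_cfg (qsstarGIter k v) p
  rw [h, plaqHol_qsstarGIter_of_mem hd k hk v hp]

/-- kernel: off the edge plaquettes `(Q^{s*}_{k+1}v)(∂p) = 1` (gen-3 `plaqHol_qsstarGIter_of_not_mem`).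
[cite: BalabanImbrieJaffe1988, (5.6.2) p.286] -/
theorem plaqVar_qsstarGIter_of_not_mem (hd : 2 ≤ P.d) {k : ℕ} (hk : i + k ≤ P.m + P.K) (v : GaugeField P (i + k) U1)
    {p : Balaban1983to89.Plaq P i} (hp : ∀ p', p ∉ (torusEdgeCellsIter P i k hd).B p') :
    plaqVar (fun b => toC (qsstarGIter k v b)) p = 1 := by
  have h : plaqVar (fun b => toC (qsstarGIter k v b)) p = toC (GaugeField.plaqHol (qsstarGIter k v) p) :=
    plaqVar_cfg (qsstarGIter k v) p
  rw [h, plaqHol_qsstarGIter_of_not_mem hd k hk v hp, toC_one]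

/-- kernel: the plaquette value of a `U(1)` field read in `ℂ` is nonzero (unit modulus). [cite: BalabanImbrieJaffe1988, (5.6.2) p.286] -/
theorem toC_plaqHol_ne_zero {m : ℕ} (v : GaugeField P m U1) (p : Balaban1983to89.Plaq P m) : toC (GaugeField.plaqHol v p) ≠ 0 := by
  intro h
  have h1 := norm_toC (GaugeField.plaqHol v p)
  rw [h, norm_zero] at h1
  exact zero_ne_one h1

/-- **(5.6.2) on the torus, edge plaquettes**: on the η-lattice torus (level `i`), with `Q^{s*}_{k+1}v = qsstarGIter (k+1) v` read in `ℂ`, `θ_k` with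
the printed support clauses for `Λ̄₆* = starB Λ6`, `p ∈ Λ̄₆**` lying in the `(k+1)`-fold edge plaquette set `B^e_{k+1}(p′)`:
`f̃^η_{k+1}(p) = η⁻²f(p′) − L⁻²(∂^η DXf)(p)` with `f(p′) = (ie_k)⁻¹ log v(p′)` (p. 280; r18's `fieldStrength e_k`), on the principal branch
(`−e_kη²L⁻²(∂^η DXf)(p) ∈ (−π, π]`, `arg v(p′) − e_kη²L⁻²(∂^η DXf)(p) ∈ (−π, π]`). [cite: BalabanImbrieJaffe1988, (5.6.2) p.286] -/
theorem fK_uTilde561_torus_of_mem (hd : 2 ≤ P.d) {k : ℕ} (hk : i + k + 1 ≤ P.m + P.K) {e η : ℝ} (he : e ≠ 0) (hη : η ≠ 0) (L : ℝ)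
    (v : GaugeField P (i + k + 1) U1) {Λ6 : Finset (Balaban1983to89.Site P i)} {Λ5s : Set (PBond P i)} {θ : PBond P i → ℝ}
    (hθ : IsTheta561 (↑(starB Λ6) : Set (PBond P i)) Λ5s θ) (HA DXf : PBond P i → ℝ) {p : Balaban1983to89.Plaq P i}
    (hp : p ∈ starP Λ6) {p' : Balaban1983to89.Plaq P (i + k + 1)} (hpp' : p ∈ (torusEdgeCellsIter P i (k + 1) hd).B p')
    (ht : e * η ^ 2 * (-(L⁻¹ ^ 2 * curl η⁻¹ DXf p)) ∈ Set.Ioc (-Real.pi) Real.pi)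
    (hsum : arg (toC (GaugeField.plaqHol v p')) + e * η ^ 2 * (-(L⁻¹ ^ 2 * curl η⁻¹ DXf p)) ∈ Set.Ioc (-Real.pi) Real.pi) :
    fK e η (plaqVar (uTilde561 e η L (fun b => toC (qsstarGIter (k + 1) v b)) θ HA DXf) p) =
      ((η : ℂ) ^ 2)⁻¹ * fieldStrength e (toC (GaugeField.plaqHol v p')) - L⁻¹ ^ 2 * curl η⁻¹ DXf p := by
  have hQ : plaqVar (fun b => toC (qsstarGIter (k + 1) v b)) p = toC (GaugeField.plaqHol v p') :=
    plaqVar_qsstarGIter_of_mem hd (k := k + 1) hk v hpp'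
  have hz : plaqVar (fun b => toC (qsstarGIter (k + 1) v b)) p ≠ 0 := by rw [hQ]; exact toC_plaqHol_ne_zero v p'
  rw [fK_uTilde561_of_mem_starP he hη L _ hθ HA DXf hp hz ht (by rw [hQ]; exact hsum), hQ, fK_eq_fieldStrength]

/-- **(5.6.2) on the torus, off the edge plaquettes**: for `p ∈ Λ̄₆**` inside a `(k+1)`-block face-interior (`p ∉ B^e_{k+1}(p′)` for all `p′`),
`(Q^{s*}_{k+1}v)(∂p) = 1` and `f̃^η_{k+1}(p) = −L⁻²(∂^η DXf)(p)` (principal branch: `−e_kη²L⁻²(∂^η DXf)(p) ∈ (−π, π]`).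
[cite: BalabanImbrieJaffe1988, (5.6.2) p.286] -/
theorem fK_uTilde561_torus_of_not_mem (hd : 2 ≤ P.d) {k : ℕ} (hk : i + k + 1 ≤ P.m + P.K) {e η : ℝ} (he : e ≠ 0) (hη : η ≠ 0)
    (L : ℝ) (v : GaugeField P (i + k + 1) U1) {Λ6 : Finset (Balaban1983to89.Site P i)} {Λ5s : Set (PBond P i)} {θ : PBond P i → ℝ}
    (hθ : IsTheta561 (↑(starB Λ6) : Set (PBond P i)) Λ5s θ) (HA DXf : PBond P i → ℝ) {p : Balaban1983to89.Plaq P i}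
    (hp : p ∈ starP Λ6) (hnot : ∀ p' : Balaban1983to89.Plaq P (i + k + 1), p ∉ (torusEdgeCellsIter P i (k + 1) hd).B p')
    (ht : e * η ^ 2 * (-(L⁻¹ ^ 2 * curl η⁻¹ DXf p)) ∈ Set.Ioc (-Real.pi) Real.pi) :
    fK e η (plaqVar (uTilde561 e η L (fun b => toC (qsstarGIter (k + 1) v b)) θ HA DXf) p) = -(L⁻¹ ^ 2 * curl η⁻¹ DXf p) := by
  have hQ : plaqVar (fun b => toC (qsstarGIter (k + 1) v b)) p = 1 :=
    plaqVar_qsstarGIter_of_not_mem hd (k := k + 1) hk v hnot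
  have hz : plaqVar (fun b => toC (qsstarGIter (k + 1) v b)) p ≠ 0 := by rw [hQ]; exact one_ne_zero
  have hsum : arg (plaqVar (fun b => toC (qsstarGIter (k + 1) v b)) p) + e * η ^ 2 * (-(L⁻¹ ^ 2 * curl η⁻¹ DXf p)) ∈
      Set.Ioc (-Real.pi) Real.pi := by
    rw [hQ, arg_one, zero_add]; exact ht
  rw [fK_uTilde561_of_mem_starP he hη L _ hθ HA DXf hp hz ht hsum, hQ, fK_one]
  push_cast
  ring

/-- **«except for scaling, this reduces to the form in the induction hypothesis»** — the (4.13) SHAPE at `k+1` with the factor `L⁻²` displayed: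
on every plaquette `p ∈ Λ̄₆**`, `f̃^η_{k+1}(p) = L⁻²[(Q^{e*}_{k+1}f)(p) − (∂^η DXf)(p)]`, where `Q^{e*}_{k+1}` is the `Cells.Qstar` of the `(k+1)`-fold
edge geometry (gen-2 `torusEdgeCellsIter`, factor `L^{2(k+1)}`) applied to the coarse field strength `f(p′) = (ie_k)⁻¹ log v(p′)` of p. 280, given
as a REAL plaquette function `F` (hypothesis `hF : F(p′) = fieldStrength e_k (v(∂p′))`), and `ηLᵏ = 1` turns `η⁻²f(p′)` into `L⁻²·L^{2(k+1)}f(p′)`;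
the two cases `fK_uTilde561_torus_of_mem/_of_not_mem` combined (principal-branch hypotheses on the edge plaquettes).
[cite: BalabanImbrieJaffe1988, (5.6.2) p.286] -/
theorem fK_uTilde561_torus_eq_Qstar (hd : 2 ≤ P.d) {k : ℕ} (hk : i + k + 1 ≤ P.m + P.K) {e η : ℝ} (he : e ≠ 0)
    (hηL : η * (P.L : ℝ) ^ k = 1) (v : GaugeField P (i + k + 1) U1) {Λ6 : Finset (Balaban1983to89.Site P i)} {Λ5s : Set (PBond P i)}
    {θ : PBond P i → ℝ} (hθ : IsTheta561 (↑(starB Λ6) : Set (PBond P i)) Λ5s θ) (HA DXf : PBond P i → ℝ)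
    (F : Balaban1983to89.Plaq P (i + k + 1) → ℝ) (hF : ∀ p', (F p' : ℂ) = fieldStrength e (toC (GaugeField.plaqHol v p')))
    {p : Balaban1983to89.Plaq P i} (hp : p ∈ starP Λ6)
    (ht : e * η ^ 2 * (-((P.L : ℝ)⁻¹ ^ 2 * curl η⁻¹ DXf p)) ∈ Set.Ioc (-Real.pi) Real.pi)
    (hsum : ∀ p' : Balaban1983to89.Plaq P (i + k + 1), p ∈ (torusEdgeCellsIter P i (k + 1) hd).B p' →
      arg (toC (GaugeField.plaqHol v p')) + e * η ^ 2 * (-((P.L : ℝ)⁻¹ ^ 2 * curl η⁻¹ DXf p)) ∈ Set.Ioc (-Real.pi) Real.pi) :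
    fK e η (plaqVar (uTilde561 e η (P.L : ℝ) (fun b => toC (qsstarGIter (k + 1) v b)) θ HA DXf) p) =
      (((P.L : ℝ)⁻¹ ^ 2 * ((torusEdgeCellsIter P i (k + 1) hd).Qstar F p - curl η⁻¹ DXf p) : ℝ) : ℂ) := by
  have hL : (P.L : ℝ) ≠ 0 := by have := P.L_pos; positivity
  have hL' : (P.L : ℂ) ≠ 0 := by exact_mod_cast hL
  have hη : η ≠ 0 := by rintro rfl; simp at hηL
  by_cases hmem : ∃ p' : Balaban1983to89.Plaq P (i + k + 1), p ∈ (torusEdgeCellsIter P i (k + 1) hd).B p'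
  · obtain ⟨p', hpp'⟩ := hmem
    rw [fK_uTilde561_torus_of_mem hd hk he hη (P.L : ℝ) v hθ HA DXf hp hpp' ht (hsum p' hpp'), ← hF p',
      Cells.Qstar_of_mem (torusEdgeCellsIter P i (k + 1) hd) F hpp', show (torusEdgeCellsIter P i (k + 1) hd).m = 2 from rfl,
      show ((torusEdgeCellsIter P i (k + 1) hd).L : ℝ) = (P.L : ℝ) ^ (k + 1) by rw [iterE_L, Nat.cast_pow]]
    have hη2 : ((η : ℂ) ^ 2)⁻¹ = (((P.L : ℝ) ^ k) ^ 2 : ℝ) := by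
      have h1 : η = ((P.L : ℝ) ^ k)⁻¹ := eq_inv_of_mul_eq_one_left hηL
      rw [h1]; push_cast; rw [inv_pow, inv_inv]
    rw [hη2]
    push_cast
    field_simp
    ring
  · push Not at hmem
    rw [fK_uTilde561_torus_of_not_mem hd hk he hη (P.L : ℝ) v hθ HA DXf hp hmem ht,
      Cells.Qstar_of_not_mem (torusEdgeCellsIter P i (k + 1) hd) F hmem]
    push_cast
    ring

end

end Literature.MathematicalPhysics.QuantumFieldTheory.BalabanImbrieJaffe1984to88.BIJ88FieldStrength562
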